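import Literature.Barriers.RiemannHypothesis.TuranPartialSumsThmIIIProofs
import HarnessLib

/-!
# Status of the per-`ε` schema `Turan1948_thmIII` (Turán 1948 Thm III / Montgomery 1983 (1))

Proof-only appendix to `TuranPartialSumsThmIIIProofs.lean` (which vendors and PROVES Theorem III as
printed, `Turan1948_thmIII_printed_holds`, and Montgomery's `∀ ε` reading,
`Turan1948_thmIII_montgomery_holds`). No definition, no named fact.

The tree's `Turan1948_thmIII` (`TuranPartialSums.lean`) is the per-`ε` schema
`∀ ε ∈ (0, 1/2), TuranHypothesisIII ε → RiemannHypothesis`, printed in neither source (verdict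
*misstated*; see the companion's module docstring). This file records formally what its discharge
would take:

* `TuranHypothesisIII.mono` — the hypotheses (1) are nested in `ε`; `Turan1948_thmIII_of_near_half` —
  so the schema is equivalent to its instances for `ε` arbitrarily close to `1/2`, i.e. it asks for
  zeros of `ζ_N` with `Re s ≥ 1 + N^{−θ}` for every `θ > 0`, for infinitely many `N` (or RH);
* `Turan1948_thmIII_iff_rh_or_forall_not` — the schema says exactly "RH, or every
  `TuranHypothesisIII ε` (`0 < ε < 1/2`) fails"; the second disjunct is Montgomery's theorem
  (`not_TuranHypothesisIII_of_montgomeryThm`, conditional on the named fact `Montgomery1983_theorem`,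
  whence the tree's `Turan1948_thmIII_of_montgomeryThm`); one `ε` alone gives only
  `quasiRiemannHypothesis_of_TuranHypothesisIII`;
* `not_thmIII_printed_hypothesis_of_montgomeryThm` — granted Montgomery's theorem the printed
  hypothesis (2.4) of Theorem III fails for every `ϑ < 1` and every `K`, so Theorem III as printed is
  classically vacuous as well (its proof in the companion is nevertheless Turán's genuine argument).

## References

* [Turan1948] P. Turán, Danske Vid. Selsk. Mat.-Fys. Medd. 24 (1948), no. 17: Theorem III (p. 5); the
  `∀ ε` corollary is drawn on p. 6 and again on p. 19 (read).
* [Montgomery1983] H. L. Montgomery, *Zeros of approximations to the zeta function*, Studies in Pure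
  Mathematics (Birkhäuser 1983), 497–506: §1, (1) and the Theorem, p. 497 (read).
-/

noncomputable section

open Complex

namespace Literature.Barriers.RiemannHypothesis

/-! The remarks below record, formally, why the tree's per-`ε` schema is left undischarged: its
hypotheses are nested (larger `ε` = smaller half-plane = weaker hypothesis), so the schema is
equivalent to its instances for `ε` arbitrarily close to `1/2`; and for a fixed `ε` it says exactly
"RH, or `TuranHypothesisIII ε` fails" — Turán's argument gives neither (one `ε` yields only
`quasiRiemannHypothesis_of_TuranHypothesisIII`), while the failure of every `TuranHypothesisIII ε`,
`ε < 1/2`, is Montgomery's theorem (`not_TuranHypothesisIII_of_montgomeryThm`). -/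

/-- Monotonicity of Montgomery's hypothesis (1) in `ε`: for `ε ≤ ε'` the half-plane
`σ ≥ 1 + N^{−1/2+ε'}` is contained in `σ ≥ 1 + N^{−1/2+ε}` (`N ≥ 1`), so
`TuranHypothesisIII ε → TuranHypothesisIII ε'`. [folklore] -/
theorem TuranHypothesisIII.mono {ε ε' : ℝ} (h : TuranHypothesisIII ε) (hle : ε ≤ ε') :
    TuranHypothesisIII ε' := by
  obtain ⟨N₀, hN₀⟩ := h
  refine ⟨max N₀ 1, fun N hN s hs ↦ hN₀ N (le_of_max_le_left hN) s (le_trans ?_ hs)⟩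
  have h1 : (1 : ℝ) ≤ N := by exact_mod_cast le_of_max_le_right hN
  have := Real.rpow_le_rpow_of_exponent_le h1 (show -(1 / 2 : ℝ) + ε ≤ -(1 / 2 : ℝ) + ε' by linarith)
  linarith

/-- Hence the schema is carried by the exponents near `−0`: if `TuranHypothesisIII ε → RH` for all
`ε ∈ [ε₀, 1/2)` (some `ε₀ < 1/2`), then `Turan1948_thmIII`. In words: the per-`ε` schema asserts (besides
RH) nothing less than zeros of `ζ_N` with `Re s ≥ 1 + N^{−θ}` for every `θ > 0` and infinitely many `N`.
[folklore] -/
theorem Turan1948_thmIII_of_near_half {ε₀ : ℝ} (hε₀ : ε₀ < 1 / 2)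
    (h : ∀ ε : ℝ, ε₀ ≤ ε → 0 < ε → ε < 1 / 2 → TuranHypothesisIII ε → RiemannHypothesis) :
    Turan1948_thmIII := fun ε h0 h1 hH ↦
  h (max ε ε₀) (le_max_right _ _) (lt_max_of_lt_left h0) (max_lt h1 hε₀) (hH.mono (le_max_left _ _))

/-- The logical content of the per-`ε` schema: `Turan1948_thmIII` holds iff RH holds or every
`TuranHypothesisIII ε`, `0 < ε < 1/2`, fails. The right disjunct is what Montgomery 1983 proves
(`not_TuranHypothesisIII_of_montgomeryThm`, conditional in the tree on `Montgomery1983_theorem`), whence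
`Turan1948_thmIII_of_montgomeryThm`; no proof of the schema avoiding both disjuncts is known.
[cite: Montgomery1983, §1] -/
theorem Turan1948_thmIII_iff_rh_or_forall_not :
    Turan1948_thmIII ↔
      (RiemannHypothesis ∨ ∀ ε : ℝ, 0 < ε → ε < 1 / 2 → ¬ TuranHypothesisIII ε) := by
  refine ⟨fun h ↦ ?_, fun h ε h0 h1 hH ↦ h.elim id fun hno ↦ (hno ε h0 h1 hH).elim⟩
  by_cases hRH : RiemannHypothesis
  · exact Or.inl hRH
  · exact Or.inr fun ε h0 h1 hH ↦ hRH (h ε h0 h1 hH)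

/-- **Theorem III as printed is classically vacuous as well** (granted Montgomery's theorem): its
hypothesis (2.4) — `U_n ≠ 0` on `σ ≥ 1 + K n^{ϑ−1}` for all `n > n₀` — is the polynomial rate
hypothesis `K · N^{−(1−ϑ)}` and fails for EVERY `ϑ < 1` and every `K` (`not_TuranHypothesisRate_rpow`).
So `Turan1948_thmIII_printed` is, like `Turan1948_thmIII` and `Turan1948_criterion`, a true
implication with a false antecedent; `Turan1948_thmIII_printed_holds` (companion file) is nevertheless
Turán's genuine proof, not an ex falso. (Turán draws the `∀ ε` corollary on p. 6 and again on p. 19.)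
[cite: Montgomery1983, §1, Theorem (p. 497)] [cite: Turan1948, Theorem III (p. 5), pp. 6 and 19] -/
theorem not_thmIII_printed_hypothesis_of_montgomeryThm (h : Montgomery1983_theorem) {ϑ : ℝ} (K : ℝ)
    (hϑ : ϑ < 1) :
    ¬ ∃ n₀ : ℕ, ∀ n : ℕ, n₀ < n → ∀ s : ℂ,
        1 + K * (n : ℝ) ^ (ϑ - 1) ≤ s.re → zetaPartialSum n s ≠ 0 := by
  rintro ⟨n₀, hn₀⟩
  refine not_TuranHypothesisRate_rpow h (θ := 1 - ϑ) (K := K) (by linarith)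
    ⟨n₀ + 1, fun N hN s hs ↦ ?_⟩
  by_contra hlt
  refine hn₀ N (by omega) s ?_ hs
  rw [show ϑ - 1 = -(1 - ϑ) by ring]
  exact (not_le.1 hlt).le

end Literature.Barriers.RiemannHypothesis

end
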